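import Literature.NumberTheory.EllipticCurves.FormalGroupChartLimitLogEquivarianceProofs
import Literature.NumberTheory.EllipticCurves.ReductionHomomorphismCuspNodeProofs
import HarnessLib

/-!
# The limit logarithm, III: additive reduction — `p·E₀(K) ⊆ E₁(K)` and the logarithm on `E₀`

`Proofs` file (theorems only, no definitions, no named facts) in topic
`NumberTheory/EllipticCurves`; continuation of `FormalGroupChartLimitLogProofs` /
`FormalGroupChartLimitLogEquivarianceProofs`.  Setting: a valued field `(L, w)`
(`w : Valuation L ℝ≥0`) with valuation ring `𝒪 = w.integer`, a Weierstrass equation `W₀` over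
`𝒪` (so `W₀ ⊗ L` is `w`-integral), the subgroups `E₀(L) = W₀.nonsingularReductionSubgroup`
(points with nonsingular reduction) and `E₁(L)` (kernel of reduction; in the two renderings
`W₀.ReducesToZero` of `ReductionHomomorphism` and `FormalGroupChart.kernel w (W₀ ⊗ L)` of
`FormalGroupChart`, bridged by `mem_kernel_iff_reducesToZero'` below), and a natural number `p`
with `|p| < 1` (the residue characteristic divides `p`).

* `natCast_smul_mem_kernel_of_cusp` — **at ADDITIVE reduction (the reduction of `W₀` is a cusp:
  `Δ̃ = 0`, `c̃₄ = 0`) `p · E₀(L) ⊆ E₁(L)`**: `E₀/E₁` embeds in `Ẽ_ns(k̄) ≅ k̄⁺`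
  (`WeierstrassCurve.exists_addMonoidHom_residueField_of_cusp`, Silverman *AEC* VII.2.1 with
  III.2.5) and `k̄⁺` is killed by `p`;
* `natCast_smul_mem_level_of_cusp` — under the unramified normalisation `|x| < 1 ⇒ |x| ≤ |p|`
  moreover `p · E₀(L) ⊆ E⁽ᵖ⁾ = {P ∈ E₁ : |z(P)| ≤ |p|}`, the domain of the limit logarithm `ℓ` of
  parts I–II;
* consequently, for ANY `ℓ` with the defining property (SPEC) of part I, the **logarithm on `E₀`**
  `ℓ₀(P) := ℓ(p·P)/p` is `𝒪`-INTEGRAL (`val_limitLog_smul_div_le_one`: `|ℓ(p·P)/p| ≤ 1` — the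
  input "log_ω(E₀(K_w)) ⊆ 𝒪_w" of the `bsd-addord` SAT₀ argument), ADDITIVE on `E₀`
  (`limitLog_smul_div_add`), and EXTENDS `ℓ` (`limitLog_smul_div_eq_of_mem_level`).

NOT here (next step of the K_w-port): the surjectivity of the reduction `E₀(L) → Ẽ_ns(k) ≅ k⁺`
for henselian `𝒪` (`ReductionHomomorphismSurjectiveProofs`) and the existence of a point of
`E₀(K_w)` whose norm to `ℚ_p` does not reduce to `Õ` (trace surjectivity `k_w → 𝔽_p`), i.e. the
unit-trace element of SAT₀; Galois equivariance of `ℓ₀` (inherited from `limitLog_map` of part II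
once the consumer fixes the descent of `W₀` to the base field).

## References

* [SilvermanAEC2009] J. H. Silverman, *The Arithmetic of Elliptic Curves*, 2nd ed. (2009),
  VII.2 Prop. 2.1, III.2.5, VII.5–VII.6 (`E₀/E₁ ≅ Ẽ_ns(k)`, additive reduction `Ẽ_ns ≅ 𝔾_a`),
  IV.6.4 (the formal logarithm).

## Design

No definitions; `ℓ₀` is the expression `ℓ (p • P) / p`, never named.  The instance
`(W₀.baseChange L).IsIntegral w.integer` is taken as an argument (the consumer supplies
`⟨⟨W₀, rfl⟩⟩`).  `noncomputable section`, `open scoped Classical NNReal`; axioms standard.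
-/

noncomputable section

open scoped Classical NNReal

namespace Literature.NumberTheory.EllipticCurves.FormalGroupChart

universe u

variable {L : Type u} [Field L] {w : Valuation L ℝ≥0} (W₀ : WeierstrassCurve w.integer)
  [hV : (W₀.baseChange L).IsIntegral w.integer]

/-- **`E₁` in the two renderings of the tree** (cf. `GoodReductionLangLift`): a point of `W₀ ⊗ L`
lies in `FormalGroupChart.kernel w (W₀ ⊗ L)` (`O` and the affine points with `|x| > 1`) iff it
`ReducesToZero` in the sense of `ReductionHomomorphism` (`O` or `x ∉ 𝒪`). [folklore] -/
private theorem mem_kernel_iff_reducesToZero' (P : (W₀.baseChange L).toAffine.Point) :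
    P ∈ kernel w (W₀.baseChange L) ↔ W₀.ReducesToZero P := by
  rcases P with _ | ⟨x, y, h⟩
  · exact ⟨fun _ ↦ trivial, fun _ ↦ (kernel w (W₀.baseChange L)).zero_mem⟩
  · rw [some_mem_kernel_iff, WeierstrassCurve.reducesToZero_some_iff,
      not_mem_range_iff (Valuation.integer.integers w)]

/-- If `|p| < 1` then `p` vanishes in the algebraic closure of the residue field of `𝒪`.
[folklore] -/
private theorem natCast_algebraicClosure_residueField_eq_zero {p : ℕ} (hp : w (p : L) < 1) :
    (p : AlgebraicClosure (IsLocalRing.ResidueField w.integer)) = 0 := by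
  have h1 : IsLocalRing.residue w.integer (p : w.integer) = 0 := by
    rw [← v_algebraMap_lt_one_iff (Valuation.integer.integers w) (p : w.integer), map_natCast]
    exact hp
  have h2 : (p : AlgebraicClosure (IsLocalRing.ResidueField w.integer)) =
      algebraMap (IsLocalRing.ResidueField w.integer) _
        (IsLocalRing.residue w.integer (p : w.integer)) := by
    rw [map_natCast, map_natCast]
  rw [h2, h1, map_zero]

/-- **Additive reduction: `p · E₀(L) ⊆ E₁(L)`.**  If the reduction of `W₀` is a cusp (`Δ̃ = 0`,
`c̃₄ = 0`) and `|p| < 1`, then `p·P` lies in the kernel of reduction for every point `P` with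
nonsingular reduction: `E₀(L)/E₁(L) ↪ Ẽ_ns(k̄) ≅ k̄⁺` (Silverman, *AEC* VII.2.1 with III.2.5), a
group killed by the residue characteristic.
[cite: SilvermanAEC2009, VII.2 Prop. 2.1 and III.2.5 (PDF pp. 167, 56)] -/
theorem natCast_smul_mem_kernel_of_cusp (hΔ : IsLocalRing.residue w.integer W₀.Δ = 0)
    (hc₄ : IsLocalRing.residue w.integer W₀.c₄ = 0) {p : ℕ} (hp : w (p : L) < 1)
    {P : (W₀.baseChange L).toAffine.Point}
    (hP : P ∈ W₀.nonsingularReductionSubgroup (Valuation.integer.integers w)) :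
    p • P ∈ kernel w (W₀.baseChange L) := by
  obtain ⟨r, hr⟩ := W₀.exists_addMonoidHom_residueField_of_cusp (Valuation.integer.integers w)
    hΔ hc₄
  let P₀ : W₀.nonsingularReductionSubgroup (Valuation.integer.integers w) := ⟨P, hP⟩
  have hval : r (p • P₀) = 0 := by
    rw [map_nsmul, nsmul_eq_mul, natCast_algebraicClosure_residueField_eq_zero hp, zero_mul]
  have hred : W₀.ReducesToZero ((p • P₀ : W₀.nonsingularReductionSubgroup
      (Valuation.integer.integers w)) : (W₀.baseChange L).toAffine.Point) := (hr _).mp hval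
  have hred' : W₀.ReducesToZero (p • P) := by
    rw [AddSubgroup.coe_nsmul] at hred
    exact hred
  rw [mem_kernel_iff_reducesToZero']
  exact hred'

/-- **Additive reduction, unramified normalisation: `p · E₀(L) ⊆ E⁽ᵖ⁾`** — under
`|x| < 1 ⇒ |x| ≤ |p|` the kernel of reduction is the level `E⁽ᵖ⁾` (`level_val_natCast_eq_kernel`),
the domain of the limit logarithm. [cite: SilvermanAEC2009, VII.2 Prop. 2.1 with Thm. IV.6.4(b)] -/
theorem natCast_smul_mem_level_of_cusp (hΔ : IsLocalRing.residue w.integer W₀.Δ = 0)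
    (hc₄ : IsLocalRing.residue w.integer W₀.c₄ = 0) {p : ℕ} (hp : w (p : L) < 1)
    (hdisc : ∀ x : L, w x < 1 → w x ≤ w (p : L))
    {P : (W₀.baseChange L).toAffine.Point}
    (hP : P ∈ W₀.nonsingularReductionSubgroup (Valuation.integer.integers w)) :
    p • P ∈ level w (W₀.baseChange L) (w (p : L)) := by
  rw [level_val_natCast_eq_kernel hdisc]
  exact natCast_smul_mem_kernel_of_cusp W₀ hΔ hc₄ hp hP

variable {W₀} {p : ℕ} {ℓ : (W₀.baseChange L).toAffine.Point → L}

/-- **The logarithm on `E₀` is `𝒪`-integral at additive reduction**: for any `ℓ` with (SPEC) on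
`E⁽ᵖ⁾` and `P ∈ E₀(L)`, `|ℓ(p·P)/p| ≤ 1` (since `p·P ∈ E⁽ᵖ⁾` and `|ℓ| ≤ |p|` there) — the input
"log_ω(E₀(K_w)) ⊆ 𝒪_w" of the SAT₀ argument (`bsd-addord`, crux `KatoKuriharaPortThreeShared`).
[cite: SilvermanAEC2009, Thm. IV.6.4(b) with VII.2 Prop. 2.1] -/
theorem val_limitLog_smul_div_le_one (hΔ : IsLocalRing.residue w.integer W₀.Δ = 0)
    (hc₄ : IsLocalRing.residue w.integer W₀.c₄ = 0) (hp0 : (p : L) ≠ 0) (hp : w (p : L) < 1)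
    (hdisc : ∀ x : L, w x < 1 → w x ≤ w (p : L))
    (hℓ : ∀ Q ∈ level w (W₀.baseChange L) (w (p : L)), ∀ r : ℕ,
      w (ℓ Q - ((p ^ r) • Q).zCoord / (p : L) ^ r) ≤ w (p : L) ^ (r + 1))
    {P : (W₀.baseChange L).toAffine.Point}
    (hP : P ∈ W₀.nonsingularReductionSubgroup (Valuation.integer.integers w)) :
    w (ℓ (p • P) / (p : L)) ≤ 1 := by
  have hp' : 0 < w (p : L) := (Valuation.pos_iff w).mpr hp0
  rw [map_div₀, div_le_iff₀ hp', one_mul]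
  exact val_limitLog_le_val_natCast hp0 hp hℓ (natCast_smul_mem_level_of_cusp W₀ hΔ hc₄ hp hdisc hP)

/-- **The logarithm on `E₀` is additive**: `ℓ(p·(P + Q))/p = ℓ(p·P)/p + ℓ(p·Q)/p` for
`P, Q ∈ E₀(L)` (additive reduction, unramified normalisation).
[cite: SilvermanAEC2009, Thm. IV.6.4(a) with VII.2 Prop. 2.1] -/
theorem limitLog_smul_div_add (hΔ : IsLocalRing.residue w.integer W₀.Δ = 0)
    (hc₄ : IsLocalRing.residue w.integer W₀.c₄ = 0) (hp0 : (p : L) ≠ 0) (hp : w (p : L) < 1)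
    (hdisc : ∀ x : L, w x < 1 → w x ≤ w (p : L))
    (hℓ : ∀ Q ∈ level w (W₀.baseChange L) (w (p : L)), ∀ r : ℕ,
      w (ℓ Q - ((p ^ r) • Q).zCoord / (p : L) ^ r) ≤ w (p : L) ^ (r + 1))
    {P Q : (W₀.baseChange L).toAffine.Point}
    (hP : P ∈ W₀.nonsingularReductionSubgroup (Valuation.integer.integers w))
    (hQ : Q ∈ W₀.nonsingularReductionSubgroup (Valuation.integer.integers w)) :
    ℓ (p • (P + Q)) / (p : L) = ℓ (p • P) / (p : L) + ℓ (p • Q) / (p : L) := by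
  rw [nsmul_add, limitLog_add hp0 hp hℓ (natCast_smul_mem_level_of_cusp W₀ hΔ hc₄ hp hdisc hP)
    (natCast_smul_mem_level_of_cusp W₀ hΔ hc₄ hp hdisc hQ), add_div]

/-- **The logarithm on `E₀` extends `ℓ`**: for `P` already in the level `E⁽ᵖ⁾`,
`ℓ(p·P)/p = ℓ(P)`. [cite: SilvermanAEC2009, Thm. IV.6.4(a)] -/
theorem limitLog_smul_div_eq_of_mem_level (hp0 : (p : L) ≠ 0) (hp : w (p : L) < 1)
    (hℓ : ∀ Q ∈ level w (W₀.baseChange L) (w (p : L)), ∀ r : ℕ,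
      w (ℓ Q - ((p ^ r) • Q).zCoord / (p : L) ^ r) ≤ w (p : L) ^ (r + 1))
    {P : (W₀.baseChange L).toAffine.Point} (hP : P ∈ level w (W₀.baseChange L) (w (p : L))) :
    ℓ (p • P) / (p : L) = ℓ P := by
  rw [limitLog_nsmul hp0 hp hℓ hP p, mul_div_cancel_left₀ _ hp0]

/-- **The logarithm on `E₀` and negation**: `ℓ(p·(−P))/p = −(ℓ(p·P)/p)` for `P ∈ E₀(L)`.
[cite: SilvermanAEC2009, Thm. IV.6.4(a) with VII.2 Prop. 2.1] -/
theorem limitLog_smul_div_neg (hΔ : IsLocalRing.residue w.integer W₀.Δ = 0)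
    (hc₄ : IsLocalRing.residue w.integer W₀.c₄ = 0) (hp0 : (p : L) ≠ 0) (hp : w (p : L) < 1)
    (hdisc : ∀ x : L, w x < 1 → w x ≤ w (p : L))
    (hℓ : ∀ Q ∈ level w (W₀.baseChange L) (w (p : L)), ∀ r : ℕ,
      w (ℓ Q - ((p ^ r) • Q).zCoord / (p : L) ^ r) ≤ w (p : L) ^ (r + 1))
    {P : (W₀.baseChange L).toAffine.Point}
    (hP : P ∈ W₀.nonsingularReductionSubgroup (Valuation.integer.integers w)) :
    ℓ (p • (-P)) / (p : L) = -(ℓ (p • P) / (p : L)) := by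
  rw [smul_neg, limitLog_neg hp0 hp hℓ (natCast_smul_mem_level_of_cusp W₀ hΔ hc₄ hp hdisc hP),
    neg_div]

end Literature.NumberTheory.EllipticCurves.FormalGroupChart

end
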